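import Mathlib
import Summits.Ventures.DiscreteObjects.Mahler.DobrowolskiWeakBound
import Summits.Ventures.DiscreteObjects.Mahler.DobrowolskiClassReduction
import Summits.Ventures.DiscreteObjects.Mahler.SubLehmerStructure
import Summits.Ventures.DiscreteObjects.Mahler.GraeffeIdentity
import Summits.Ventures.DiscreteObjects.Mahler.LowDegreeMeasures

/-!
# The weak Dobrowolski bound `M(f) > 1 + 1/(22 d)`, unconditional (venture `DiscreteObjects`, target L)

Cell `pub-namedobj`, seat `pub-namedobj-mahler-g26`. Framing: lottery ticket; floor = certified bounds/negative ranges.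

[cite: MckeeSmyth2021, Theorem 3.11] (weak version of Dobrowolski 1979): **every monic irreducible `f ∈ ℤ[X]` with
`f(0) ≠ 0`, no cyclotomic factor and degree `d ≥ 1` has `M(f) > 1 + 1/(22 d)`** (`weakDobrowolski`).  KERNEL REPLICATION
of the printed proof: strong induction on `d`; for a prime `p ∈ (6d, 12d)` either the `p`-th powers of the roots are
distinct and the analytic core applies (`weakDobrowolski_of_pow_nodup`, `DobrowolskiWeakBound`), or two roots have equal
`p`-th powers and [MckeeSmyth2021, Lemma 3.8] (`exists_irreducible_of_lower_degree`, `DobrowolskiClassReduction`)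
produces a monic irreducible `g` with `1 < M(g) ≤ M(f)` and smaller degree, to which the induction hypothesis applies.
Corollaries: `weakDobrowolski_of_irreducible` (irreducible `f`, `M(f) > 1`) and **`weakDobrowolski_of_measure_gt_one`:
every `P ∈ ℤ[X]` with `M(P) > 1` has `M(P) > 1 + 1/(22 · deg P)`**; and the printed element form `weakDobrowolski_algInt`
(`α ∈ ℂ` a nonzero algebraic integer, not a root of unity ⇒ `M(minpoly_ℤ α) > 1 + 1/(22 deg)`).  No new mathematics.
-/

namespace Summit.Ventures.DiscreteObjects.Mahler

open Polynomial

/-- An irreducible integer polynomial of Mahler measure `> 1` has positive degree and no cyclotomic divisor. -/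
theorem natDegree_pos_and_not_cyclotomic_dvd_of_measure_gt_one {g : ℤ[X]} (hgirr : Irreducible g)
    (hMg : 1 < intMahlerMeasure g) (hgmon : g.Monic) :
    0 < g.natDegree ∧ ∀ m : ℕ, 0 < m → ¬ cyclotomic m ℤ ∣ g := by
  refine ⟨?_, ?_⟩
  · by_contra hd
    push Not at hd
    have hd0 : g.natDegree = 0 := Nat.le_zero.1 hd
    have hg1 : g = 1 := by
      rw [eq_C_of_natDegree_eq_zero hd0]
      have : g.coeff 0 = 1 := by
        have h := hgmon.leadingCoeff
        rwa [leadingCoeff, hd0] at h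
      rw [this, C_1]
    rw [hg1] at hMg
    have : intMahlerMeasure (1 : ℤ[X]) = 1 := by
      rw [show (1 : ℤ[X]) = C 1 from C_1.symm, intMahlerMeasure_C]
      simp
    linarith
  · intro m hm hdvd
    have hnu : ¬ IsUnit (cyclotomic m ℤ) := fun hu => by
      have h0 := natDegree_eq_zero_of_isUnit hu
      rw [natDegree_cyclotomic] at h0
      have := Nat.totient_pos.mpr hm
      omega
    have h1 := measure_eq_one_of_irreducible_of_dvd hgirr hdvd hnu (intMahlerMeasure_cyclotomic m)
    linarith

/-- **The weak Dobrowolski bound [MckeeSmyth2021, Theorem 3.11], unconditional kernel theorem.**  Every monic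
irreducible `f ∈ ℤ[X]` with `f(0) ≠ 0`, no cyclotomic factor and degree `d ≥ 1` satisfies `M(f) > 1 + 1/(22 d)`. -/
theorem weakDobrowolski (f : ℤ[X]) (hmon : f.Monic) (hirr : Irreducible f) (h0 : f.coeff 0 ≠ 0)
    (hcf : ∀ m : ℕ, 0 < m → ¬ cyclotomic m ℤ ∣ f) (hdeg : 0 < f.natDegree) :
    1 + 1 / (22 * (f.natDegree : ℝ)) < intMahlerMeasure f := by
  classical
  suffices h : ∀ d : ℕ, ∀ f : ℤ[X], f.Monic → Irreducible f → f.coeff 0 ≠ 0 →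
      (∀ m : ℕ, 0 < m → ¬ cyclotomic m ℤ ∣ f) → 0 < f.natDegree → f.natDegree = d →
      1 + 1 / (22 * (f.natDegree : ℝ)) < intMahlerMeasure f from h _ f hmon hirr h0 hcf hdeg rfl
  intro d
  induction d using Nat.strong_induction_on with
  | _ d ih =>
    intro f hmon hirr h0 hcf hdeg hd
    -- a prime `6d < p < 12d`
    obtain ⟨p, hp, hlt, hle⟩ := Nat.exists_prime_lt_and_le_two_mul (6 * f.natDegree) (by omega)
    have hp12 : p < 12 * f.natDegree := by
      rcases hle.eq_or_lt with h | h
      · exfalso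
        have : 2 ∣ p := ⟨6 * f.natDegree, h⟩
        have h2 := (Nat.prime_dvd_prime_iff_eq Nat.prime_two hp).1 this
        omega
      · omega
    by_cases hnd : (((f.map (Int.castRingHom ℂ)).roots).map (fun a => a ^ p)).Nodup
    · exact weakDobrowolski_of_pow_nodup f hmon hirr h0 hcf hdeg hp hlt hp12 hnd
    · -- two distinct roots with equal `p`-th powers: descend by Lemma 3.8
      rw [Multiset.nodup_map_iff_inj_on (nodup_roots_of_irreducible hirr hdeg)] at hnd
      push Not at hnd
      obtain ⟨a, ha, b, hb, habp, hab⟩ := hnd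
      have hM1 : 1 < intMahlerMeasure f := by
        have h := weakDobrowolski_sq f hmon hirr h0 hcf hdeg
        have : (0 : ℝ) < 1 / (22 * ((f.natDegree : ℝ) ^ 2)) := by
          have : (0 : ℝ) < f.natDegree := by exact_mod_cast hdeg
          positivity
        linarith
      obtain ⟨g, hgmon, hgirr, hg0, hMg1, hMgle, hdeglt⟩ :=
        exists_irreducible_of_lower_degree f hmon hirr h0 hM1 ha hb hab ⟨p, hp.pos, habp⟩
      obtain ⟨hgdeg, hgcf⟩ := natDegree_pos_and_not_cyclotomic_dvd_of_measure_gt_one hgirr hMg1 hgmon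
      have ih' := ih g.natDegree (hd ▸ hdeglt) g hgmon hgirr hg0 hgcf hgdeg rfl
      have hmono : 1 / (22 * (f.natDegree : ℝ)) ≤ 1 / (22 * (g.natDegree : ℝ)) := by
        have h1 : (0 : ℝ) < g.natDegree := by exact_mod_cast hgdeg
        have h2 : (g.natDegree : ℝ) ≤ f.natDegree := by exact_mod_cast hdeglt.le
        exact one_div_le_one_div_of_le (by positivity) (by nlinarith)
      linarith

/-- **Corollary: every irreducible `f ∈ ℤ[X]` with `M(f) > 1` has `M(f) > 1 + 1/(22 · deg f)`.** -/
theorem weakDobrowolski_of_irreducible {f : ℤ[X]} (hirr : Irreducible f) (hM : 1 < intMahlerMeasure f) :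
    1 + 1 / (22 * (f.natDegree : ℝ)) < intMahlerMeasure f := by
  rcases Nat.eq_zero_or_pos f.natDegree with hd0 | hdpos
  · rw [hd0]
    norm_num
    exact hM
  -- leading coefficient of modulus `≥ 2`: `M ≥ 2`
  by_cases hlc : 2 ≤ |f.leadingCoeff|
  · have h := abs_leadingCoeff_le_intMahlerMeasure f
    have : (2 : ℝ) ≤ |(f.leadingCoeff : ℝ)| := by exact_mod_cast hlc
    have hd1 : (1 : ℝ) ≤ f.natDegree := by exact_mod_cast hdpos
    have : 1 / (22 * (f.natDegree : ℝ)) ≤ 1 / 22 := by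
      apply one_div_le_one_div_of_le (by norm_num)
      linarith
    linarith
  have hf0 : f ≠ 0 := hirr.ne_zero
  have hlc1 : f.leadingCoeff = 1 ∨ f.leadingCoeff = -1 := by
    have hne : f.leadingCoeff ≠ 0 := leadingCoeff_ne_zero.mpr hf0
    have hnn := abs_nonneg f.leadingCoeff
    rcases abs_choice f.leadingCoeff with h | h <;> rw [h] at hlc hnn <;> omega
  obtain ⟨g, hgmon, hgirr, hgM, hgdeg⟩ : ∃ g : ℤ[X], g.Monic ∧ Irreducible g ∧
      intMahlerMeasure g = intMahlerMeasure f ∧ g.natDegree = f.natDegree := by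
    rcases hlc1 with h1 | h1
    · exact ⟨f, h1, hirr, rfl, rfl⟩
    · refine ⟨-f, by rw [Monic, leadingCoeff_neg, h1, neg_neg], ?_, intMahlerMeasure_neg f, natDegree_neg f⟩
      have hassoc : Associated f (-f) := ⟨-1, by simp⟩
      exact hassoc.irreducible hirr
  rw [← hgM, ← hgdeg]
  rw [← hgM] at hM
  have hg0 : g.coeff 0 ≠ 0 := by
    intro h0
    have h1 := measure_eq_one_of_irreducible_of_dvd hgirr (X_dvd_iff.mpr h0) Polynomial.not_isUnit_X
      intMahlerMeasure_X
    linarith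
  obtain ⟨hgdegpos, hcf⟩ := natDegree_pos_and_not_cyclotomic_dvd_of_measure_gt_one hgirr hM hgmon
  exact weakDobrowolski g hgmon hgirr hg0 hcf hgdegpos

/-- **Every integer polynomial with `M(P) > 1` has `M(P) > 1 + 1/(22 · deg P)`** (weak Dobrowolski bound for all of
`ℤ[X]`, via an irreducible factor of measure `> 1`). -/
theorem weakDobrowolski_of_measure_gt_one {P : ℤ[X]} (hM : 1 < intMahlerMeasure P) :
    1 + 1 / (22 * (P.natDegree : ℝ)) < intMahlerMeasure P := by
  classical
  have hP : P ≠ 0 := by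
    intro h
    rw [h] at hM
    unfold intMahlerMeasure at hM
    rw [Polynomial.map_zero, mahlerMeasure_zero] at hM
    linarith
  obtain ⟨u, hu⟩ := UniqueFactorizationMonoid.factors_prod hP
  obtain ⟨c, hc, hcu⟩ := Polynomial.isUnit_iff.mp u.isUnit
  set F := UniqueFactorizationMonoid.factors P with hF
  have hFirr : ∀ f ∈ F, Irreducible f := fun f hf => UniqueFactorizationMonoid.irreducible_of_factor f hf
  have hMu : intMahlerMeasure (↑u : ℤ[X]) = 1 := by
    rw [← hcu, intMahlerMeasure_C]
    rcases Int.isUnit_iff.mp hc with h | h <;> simp [h]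
  have hMp : intMahlerMeasure P = (F.map intMahlerMeasure).prod := by
    rw [← hu, intMahlerMeasure_mul, hMu, mul_one, intMahlerMeasure_multiset_prod]
  have hdvd : ∀ f ∈ F, f ∣ P := fun f hf => (Multiset.dvd_prod hf).trans ⟨↑u, hu.symm⟩
  have hge1 : ∀ x ∈ F.map intMahlerMeasure, 1 ≤ x := by
    intro x hx
    obtain ⟨f, hf, rfl⟩ := Multiset.mem_map.mp hx
    exact one_le_intMahlerMeasure (hFirr f hf).ne_zero
  have hprod_ge : ∀ x ∈ F.map intMahlerMeasure, x ≤ (F.map intMahlerMeasure).prod := by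
    intro x hx
    obtain ⟨T, hT⟩ := Multiset.exists_cons_of_mem hx
    rw [hT, Multiset.prod_cons]
    have hT1 : 1 ≤ T.prod :=
      Multiset.one_le_prod (fun y hy => hge1 y (by rw [hT]; exact Multiset.mem_cons_of_mem hy))
    have hx0 : 0 ≤ x := le_trans zero_le_one (hge1 x hx)
    nlinarith
  have hex : ∃ f ∈ F, 1 < intMahlerMeasure f := by
    by_contra hall
    push Not at hall
    have h1 : ∀ x ∈ F.map intMahlerMeasure, x = 1 := by
      intro x hx
      obtain ⟨f, hf, rfl⟩ := Multiset.mem_map.mp hx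
      exact le_antisymm (hall f hf) (hge1 _ hx)
    have : (F.map intMahlerMeasure).prod = 1 := Multiset.prod_eq_one h1
    rw [← hMp] at this
    linarith
  obtain ⟨f, hf, hfM⟩ := hex
  have hfle : intMahlerMeasure f ≤ intMahlerMeasure P := by
    rw [hMp]
    exact hprod_ge _ (Multiset.mem_map_of_mem _ hf)
  have hfdeg : f.natDegree ≤ P.natDegree := natDegree_le_of_dvd (hdvd f hf) hP
  have hfb := weakDobrowolski_of_irreducible (hFirr f hf) hfM
  rcases Nat.eq_zero_or_pos f.natDegree with hd0 | hdpos
  · -- a constant irreducible factor of measure `> 1` has measure `≥ 2`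
    have hfC : f = C (f.coeff 0) := eq_C_of_natDegree_eq_zero hd0
    have h2 : (2 : ℝ) ≤ intMahlerMeasure f := by
      rw [hfC, intMahlerMeasure_C] at hfM ⊢
      have h1 : (1 : ℤ) < |f.coeff 0| := by exact_mod_cast hfM
      have : (2 : ℤ) ≤ |f.coeff 0| := h1
      exact_mod_cast this
    rcases Nat.eq_zero_or_pos P.natDegree with hP0 | hPpos
    · rw [hP0]
      norm_num
      exact hM
    · have hd1 : (1 : ℝ) ≤ P.natDegree := by exact_mod_cast hPpos
      have : 1 / (22 * (P.natDegree : ℝ)) ≤ 1 / 22 := by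
        apply one_div_le_one_div_of_le (by norm_num)
        linarith
      linarith
  · have hmono : 1 / (22 * (P.natDegree : ℝ)) ≤ 1 / (22 * (f.natDegree : ℝ)) := by
      have h1 : (0 : ℝ) < f.natDegree := by exact_mod_cast hdpos
      have h2 : (f.natDegree : ℝ) ≤ P.natDegree := by exact_mod_cast hfdeg
      exact one_div_le_one_div_of_le (by positivity) (by nlinarith)
    linarith

/-- **[MckeeSmyth2021, Theorem 3.11] as printed: for every nonzero algebraic integer `α` of degree `d` that is not a
root of unity, `M(α) > 1 + 1/(22 d)`** — here `α ∈ ℂ` integral over `ℤ`, `M(α) = M(minpoly_ℤ α)`, `d = deg minpoly_ℤ α`. -/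
theorem weakDobrowolski_algInt {α : ℂ} (hα : IsIntegral ℤ α) (hα0 : α ≠ 0) (hnu : ∀ n : ℕ, 0 < n → α ^ n ≠ 1) :
    1 + 1 / (22 * ((minpoly ℤ α).natDegree : ℝ)) < intMahlerMeasure (minpoly ℤ α) := by
  set f := minpoly ℤ α with hf
  have hmon : f.Monic := minpoly.monic hα
  have hirr : Irreducible f := minpoly.irreducible hα
  have hdeg : 0 < f.natDegree := minpoly.natDegree_pos hα
  have hαQ : IsIntegral ℚ α := hα.tower_top
  have hfQ : f.map (algebraMap ℤ ℚ) = minpoly ℚ α := (minpoly.isIntegrallyClosed_eq_field_fractions' ℚ hα).symm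
  have h0 : f.coeff 0 ≠ 0 := by
    intro h
    have h1 : (minpoly ℚ α).coeff 0 = 0 := by rw [← hfQ, coeff_map, h, map_zero]
    exact minpoly.coeff_zero_ne_zero hαQ hα0 h1
  have hcf : ∀ m : ℕ, 0 < m → ¬ cyclotomic m ℤ ∣ f := by
    intro m hm hdvd
    -- `f` is irreducible, so `f ~ Φ_m`; then `α` is a root of `Φ_m`, hence `α^m = 1`
    have hassoc : Associated (cyclotomic m ℤ) f := (cyclotomic.irreducible hm).associated_of_dvd hirr hdvd
    have hroot : f.map (Int.castRingHom ℂ) ∣ (cyclotomic m ℤ).map (Int.castRingHom ℂ) :=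
      Polynomial.map_dvd _ hassoc.symm.dvd
    have hfα : (f.map (Int.castRingHom ℂ)).eval α = 0 := by
      rw [eval_map, ← algebraMap_int_eq, ← aeval_def, hf, minpoly.aeval]
    haveI : NeZero (m : ℂ) := ⟨by exact_mod_cast hm.ne'⟩
    have hΦα : (cyclotomic m ℂ).IsRoot α := by
      rw [← map_cyclotomic_int, IsRoot]
      exact eval_eq_zero_of_dvd_of_eval_eq_zero hroot hfα
    rw [isRoot_cyclotomic_iff] at hΦα
    exact hnu m hm (hΦα.pow_eq_one)
  exact weakDobrowolski f hmon hirr h0 hcf hdeg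

end Summit.Ventures.DiscreteObjects.Mahler
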